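import Literature.MathematicalPhysics.QuantumFieldTheory.YangMillsOS
import Literature.MathematicalPhysics.QuantumLattice.WilsonBlockHeatBathLightCone2
import Literature.MathematicalPhysics.QuantumLattice.WilsonBlockHeatBathSemigroup
import Literature.MathematicalPhysics.QuantumFieldTheory.LatticeRPMechanism

/-!
# `LatticeGapLargeBeta` — line `Sketch` (card `af-staircase-transport`): the anchor at `β = 0`
# (stub `stub_anchorZero`)

Support file for crux `stmt-QuantumFields-8761`
(`Summit.QuantumFields.YangMills.Theses.EquipartitionCriticality.LatticeGapLargeBeta`): this is stub
`stub_anchorZero` of line `Sketch`, the anchor SC(0, S, 1, 2) of the clustering currency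

  SC(β, S, m, K) :≡ ∀ (A B : YMSpecies G) (a b : ℝ) (w : ℕ), (∀ U, |A.F U| ≤ a) → (∀ U, |B.F U| ≤ b) →
    (∀ e ∈ A.supp, |e.1 0| ≤ w) → (∀ e ∈ B.supp, |e.1 0| ≤ w) → ∀ n ≤ S,
    |latticeConnectedCorr r.ρ β (2S+1) A.F B.F n| ≤ K · a · b · e^{m·2w} · e^{−m n}.

Mathematics.  At `β = 0` the density `exp(−β S(U))` is `1`, so the torus Wilson state
`wilsonMeasure r.ρ 0` on `(2S+1)⁴` is the product of the Haar probability measures over the links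
(computed inline: `withDensity_one`, total mass `1`; the same computation as the tree's
`LatticeGapOnTrajectory.Negative.wilsonMeasure_zero_coupling`, not imported to keep this line's import
cone inside `Literature`).  Read through the periodic lift, `A ∘ torusLift` depends only on the torus
edges below `A.supp` (time coordinates in `[−w, w]`) and `B ∘ configShift(−n e₀) ∘ torusLift` only on
those below `B.supp + n e₀` (time coordinates in `[n − w, n + w]`); for `2w < n ≤ S` these two windows are
disjoint modulo `2S+1` (`disjoint_image_torusEdge_shift`), so the two observables are independent under
the product measure (`integral_mul_eq_of_dependsOn_real`) and the connected correlation VANISHES.  For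
`n ≤ 2w` the a priori bound `|corr| ≤ 2ab` (`WilsonBlockHeatBath.abs_latticeConnectedCorr_le_two_mul`)
is at most `2ab · e^{2w} e^{−n}` because `e^{2w − n} ≥ 1`.
-/

open scoped BigOperators Topology
open MeasureTheory ProbabilityTheory Filter
open Literature.MathematicalPhysics.QuantumFieldTheory Literature.MathematicalPhysics.QuantumLattice

noncomputable section

namespace Summit.QuantumFields.YangMills.Theorems.LatticeGapLargeBeta.AfStaircase

/-- **Independence of disjoint coordinate blocks under a finite product probability measure** (real
version of `LatticeRP.integral_mul_eq_of_dependsOn`): if `f` depends only on the coordinates in `S`,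
`g` only on those in `T`, and `S ∩ T = ∅`, then `∫ f g = ∫ f · ∫ g` under `Measure.pi (fun _ => ν)`.
[folklore] -/
theorem integral_mul_eq_of_dependsOn_real {ι : Type*} [Fintype ι] [DecidableEq ι] {Y : Type*}
    [MeasurableSpace Y] (ν : Measure Y) [IsProbabilityMeasure ν] {S T : Finset ι}
    (hST : Disjoint S T) {f g : (ι → Y) → ℝ} (hf : Measurable f) (hg : Measurable g)
    (hfS : DependsOn f (S : Set ι)) (hgT : DependsOn g (T : Set ι)) :
    ∫ U, f U * g U ∂(Measure.pi fun _ : ι => ν) =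
      (∫ U, f U ∂(Measure.pi fun _ : ι => ν)) * ∫ U, g U ∂(Measure.pi fun _ : ι => ν) := by
  -- adapted from Literature.MathematicalPhysics.QuantumFieldTheory.LatticeRP.integral_mul_eq_of_dependsOn
  obtain ⟨x₀⟩ : Nonempty (ι → Y) := by
    have : Nonempty Y := nonempty_of_isProbabilityMeasure ν
    infer_instance
  have hXY := LatticeRP.indepFun_restrict ν S T hST
  set f' : (S → Y) → ℝ := fun a => f (Function.updateFinset x₀ S a)
  set g' : (T → Y) → ℝ := fun b => g (Function.updateFinset x₀ T b)
  have hf' : Measurable f' := hf.comp measurable_updateFinset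
  have hg' : Measurable g' := hg.comp measurable_updateFinset
  have hff : ∀ U, f' (fun i : S => U i) = f U := fun U =>
    LatticeRP.apply_updateFinset_restrict S x₀ hfS U
  have hgg : ∀ U, g' (fun i : T => U i) = g U := fun U =>
    LatticeRP.apply_updateFinset_restrict T x₀ hgT U
  have := hXY.integral_fun_comp_mul_comp
    (measurable_pi_lambda _ fun i => measurable_pi_apply _).aemeasurable
    (measurable_pi_lambda _ fun i => measurable_pi_apply _).aemeasurable
    hf'.aestronglyMeasurable hg'.aestronglyMeasurable
  simpa only [hff, hgg] using this

/-- **Time-separated supports project disjointly onto a large torus.**  If all bonds of `TA`, `TB`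
have time coordinate in `[−R, R]`, then for `2R + 1 ≤ n ≤ S'` the projections of `TA + 0·e₀` and of
`TB + n e₀` onto the torus of side `2S'+1` are disjoint (a common edge would force
`2S'+1 ∣ (x₀ + 0) − (y₀ + n)` with `1 ≤ (y₀ + n) − x₀ ≤ 2S'`). [folklore] -/
theorem disjoint_image_torusEdge_shift {TA TB : Finset (Literature.MathematicalPhysics.QuantumLattice.ZdEdge 4)} {R : ℕ}
    (hA : ∀ e ∈ TA, |e.1 0| ≤ (R : ℤ)) (hB : ∀ e ∈ TB, |e.1 0| ≤ (R : ℤ)) {S' n : ℕ}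
    (hn1 : 2 * R + 1 ≤ n) (hn2 : n ≤ S') :
    Disjoint (TA.image fun e => torusEdge (2 * S' + 1) (e.1 + Pi.single 0 ((0 : ℕ) : ℤ), e.2))
      (TB.image fun e => torusEdge (2 * S' + 1) (e.1 + Pi.single 0 ((n : ℕ) : ℤ), e.2)) := by
  -- adapted from Summit.QuantumFields.YangMills.Cruxes.ContinuumLimitOnTrajectory.Disproof
  -- (`Ultralocal.disjoint_image_torusEdge`)
  rw [Finset.disjoint_left]
  rintro _ ha hb
  obtain ⟨a, haT, rfl⟩ := Finset.mem_image.1 ha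
  obtain ⟨b, hbT, hab⟩ := Finset.mem_image.1 hb
  have h0 : (Literature.Probability.LatticeModels.Torus.proj (2 * S' + 1) (b.1 + Pi.single 0 ((n : ℕ) : ℤ))) 0 =
      (Literature.Probability.LatticeModels.Torus.proj (2 * S' + 1) (a.1 + Pi.single 0 ((0 : ℕ) : ℤ))) 0 := by
    have := (Prod.ext_iff.1 hab).1
    simp only [torusEdge] at this
    rw [this]
  simp only [Literature.Probability.LatticeModels.Torus.proj_apply, Pi.add_apply, Pi.single_eq_same,
    Nat.cast_zero, add_zero] at h0
  rw [ZMod.intCast_eq_intCast_iff_dvd_sub] at h0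
  have ha' := abs_le.1 (hA a haT)
  have hb' := abs_le.1 (hB b hbT)
  have h1 : (1 : ℤ) ≤ (b.1 0 + n) - a.1 0 := by omega
  have h2 : (b.1 0 + n) - a.1 0 < ((2 * S' + 1 : ℕ) : ℤ) := by push_cast; omega
  have h3 := Int.le_of_dvd (by omega) (dvd_sub_comm.1 h0)
  omega

/-- `stub_anchorZero` — **the anchor at `β = 0`**: SC(0, S, 1, 2) for every half-side `S`.  At `β = 0`
the torus Wilson state `wilsonMeasure r.ρ 0` on `(2S+1)⁴` is the product of Haar probability measures
over the links, so two bounded observables read through the periodic lift, `A ∘ torusLift` and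
`B ∘ configShift(−n e₀) ∘ torusLift`, whose supports have time coordinates in `[−w, w]` and
`[n − w, n + w]`, are independent as soon as these two windows are disjoint mod `2S+1`, which is the
case for `2w < n ≤ S`; hence the connected correlation vanishes there, and for `n ≤ 2w` the a priori
bound `2ab ≤ 2ab·e^{2w − n}` applies. [folklore] -/
theorem stub_anchorZero :
    ∀ (G : Type) [Group G] [TopologicalSpace G] [IsTopologicalGroup G] [CompactSpace G]
      [MeasurableSpace G] [BorelSpace G] (r : LatticeRep G) (S : ℕ),
    ∀ (A B : YMSpecies G) (a b : ℝ) (w : ℕ), (∀ U, |A.F U| ≤ a) → (∀ U, |B.F U| ≤ b) →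
      (∀ e ∈ A.supp, |e.1 0| ≤ (w : ℤ)) → (∀ e ∈ B.supp, |e.1 0| ≤ (w : ℤ)) →
      ∀ n : ℕ, n ≤ S →
        |latticeConnectedCorr r.ρ 0 (2 * S + 1) A.F B.F n| ≤
          2 * a * b * Real.exp (1 * (2 * w)) * Real.exp (-(1 * n)) := by
  intro G _ _ _ _ _ _ r S A B a b w hA hB hwA hwB n hn
  classical
  have ha0 : 0 ≤ a := (abs_nonneg _).trans (hA fun _ => 1)
  have hb0 : 0 ≤ b := (abs_nonneg _).trans (hB fun _ => 1)
  by_cases hwn : 2 * w + 1 ≤ n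
  · -- time-disjoint supports: the connected correlation vanishes under product Haar
    -- at `β = 0` the torus Wilson state is the Haar product (density `e^{-0·S} = 1`, `Z = 1`); the same
    -- computation as `LatticeGapOnTrajectory.Negative.wilsonMeasure_zero_coupling` (not imported here)
    have hpi : wilsonMeasure (d := 4) (L := 2 * S + 1) r.ρ 0 =
        Measure.pi fun _ : Edge 4 (2 * S + 1) => haarProbability G := by
      have hw : wilsonWeight (d := 4) (L := 2 * S + 1) r.ρ 0 =
          Measure.pi fun _ : Edge 4 (2 * S + 1) => haarProbability G := by
        unfold wilsonWeight
        have h1 : (fun U : GaugeConfig 4 (2 * S + 1) G =>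
            ENNReal.ofReal (Real.exp (-0 * wilsonAction r.ρ U))) = 1 := by
          funext U; simp
        rw [h1, withDensity_one]
      rw [wilsonMeasure, partitionFunction, hw]
      simp
    have hcorr : latticeConnectedCorr r.ρ 0 (2 * S + 1) A.F B.F n = 0 := by
      rw [WilsonBlockHeatBath.latticeConnectedCorr_eq_integral_sub, hpi]
      obtain ⟨hAm, -, -, hAd⟩ := WilsonBlockHeatBath.shiftedObservable_props A ((0 : ℕ) : ℤ) (2 * S + 1)
      obtain ⟨hBm, -, -, hBd⟩ := WilsonBlockHeatBath.shiftedObservable_props B ((n : ℕ) : ℤ) (2 * S + 1)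
      rw [integral_mul_eq_of_dependsOn_real (haarProbability G)
        (disjoint_image_torusEdge_shift hwA hwB hwn hn) hAm hBm hAd hBd, sub_self]
    rw [hcorr, abs_zero]
    positivity
  · -- small separations `n ≤ 2w`: the a priori bound `2ab ≤ 2ab e^{2w-n}`
    have hle := WilsonBlockHeatBath.abs_latticeConnectedCorr_le_two_mul r 0 (2 * S + 1) hA hB n
    refine hle.trans ?_
    have hwn' : (n : ℝ) ≤ 2 * (w : ℝ) := by exact_mod_cast (by omega : n ≤ 2 * w)
    have hexp : (1 : ℝ) ≤ Real.exp (1 * (2 * (w : ℝ))) * Real.exp (-(1 * (n : ℝ))) := by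
      rw [← Real.exp_add]
      exact Real.one_le_exp (by linarith)
    have hab : 0 ≤ 2 * a * b := by positivity
    calc 2 * (a * b) = 2 * a * b * 1 := by ring
      _ ≤ 2 * a * b * (Real.exp (1 * (2 * (w : ℝ))) * Real.exp (-(1 * (n : ℝ)))) :=
          mul_le_mul_of_nonneg_left hexp hab
      _ = 2 * a * b * Real.exp (1 * (2 * w)) * Real.exp (-(1 * n)) := by ring

end Summit.QuantumFields.YangMills.Theorems.LatticeGapLargeBeta.AfStaircase

end
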